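import Literature.NumberTheory.DiophantineGeometry.CatalanWieferich
import Mathlib.NumberTheory.NumberField.Cyclotomic.Basic
import Mathlib.RingTheory.Polynomial.Cyclotomic.Roots
import Mathlib.Algebra.CharP.Lemmas
import Mathlib.Algebra.CharP.Quotient
import HarnessLib

/-!
# Not every cyclotomic unit is a `q`-adic `q`-th power (Schoof, Proposition 14.2: the Witt polynomial)

[Schoof2009, Proposition 14.2]: *let `p, q` be odd primes; if every cyclotomic `p`-unit of
`ℚ(ζ_p)` is a `q`-adic `q`-th power, then `p < q`.* The proof only uses the one cyclotomic unit
`ζ_p^q - 1` and "`q`-adic `q`-th power" only through the congruence `ζ^q - 1 ≡ u^q (mod q²)`; we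
prove exactly this kernel, which is what the proof of [Schoof2009, Theorem 14.1] (Mihăilescu's
Theorem II, `p > q`) consumes:

* `Catalan.not_sq_dvd_zeta_pow_sub_one_sub_pow` — for odd primes `q < p` and `ζ = ζ_p`, there is
  no algebraic integer `u` with `q² ∣ (ζ^q - 1) - u^q` in `ℤ[ζ_p]`.

Proof ([Schoof2009, p. 92]): `(ζ - 1)^q = ζ^q - 1 + q S` with `S = ∑_{0<k<q} (C(q,k)/q) (-1)^{q-k} ζ^k`
(`add_pow_prime_eq'`); so `(ζ-1)^q ≡ u^q (mod q)`, and as `ℤ[ζ_p]/(q)` is reduced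
([Schoof2009, Exercise 10.2], `Catalan.isReduced_quotient_span_prime`) `ζ - 1 ≡ u (mod q)`, whence
`(ζ-1)^q ≡ u^q ≡ ζ^q - 1 (mod q²)` ([Schoof2009, Exercise 10.1], `dvd_sub_pow_of_dvd_sub`) and
`q ∣ S`. Writing `S = P(ζ)` with `P = ∑_{0<k<q} (C(q,k)/q)(-1)^{q-k} X^k ∈ ℤ[X]` (`= T·W(T)`, `W`
the Witt polynomial) and `S/q ∈ ℤ[ζ] = ℤ[X]/(Φ_p)`, the `p`-th cyclotomic polynomial divides
`P` in `𝔽_q[X]`; as `P ≢ 0` has degree `q - 1`, `p - 1 ≤ q - 1`.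

Everything is proved; no definitions, no named facts.

## References

* R. Schoof, *Catalan's Conjecture*, Universitext, Springer 2009 [Schoof2009], Proposition 14.2
  and Exercises 10.1, 10.2, 14.2 (book pp. 92–93) — held,
  `lit read book:schoof2009-catalan-s-conjecture` (PDF p. 171).
-/

namespace Literature.NumberTheory.DiophantineGeometry

namespace Catalan

open Finset NumberField Polynomial

variable {p : ℕ} [hp : Fact p.Prime] {K : Type*} [Field K] [NumberField K]
  [IsCyclotomicExtension {p} ℚ K] {ζ : K}

/-- In `ℤ[ζ_p]`, for a prime `q ≠ p`: `q ∣ a^q - b^q` implies `q ∣ a - b` (the Frobenius of the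
reduced ring `ℤ[ζ_p]/(q)` is injective), hence `q² ∣ a^q - b^q`.
[cite: Schoof2009, Exercises 10.1, 10.2] -/
theorem sq_dvd_pow_sub_pow_of_dvd {q : ℕ} (hq : q.Prime) (hpq : p ≠ q) {a b : 𝓞 K}
    (h : (q : 𝓞 K) ∣ a ^ q - b ^ q) : (q : 𝓞 K) ∣ a - b ∧ (q : 𝓞 K) ^ 2 ∣ a ^ q - b ^ q := by
  classical
  haveI : Fact q.Prime := ⟨hq⟩
  -- `q` is not a unit of `𝓞 K`
  have hqnu : (q : 𝓞 K) ∈ nonunits (𝓞 K) := by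
    intro hu
    have h1 := hu.map (Algebra.norm ℤ (S := 𝓞 K))
    rw [← map_natCast (algebraMap ℤ (𝓞 K)), Algebra.norm_algebraMap, Int.isUnit_iff,
      RingOfIntegers.rank, IsCyclotomicExtension.Rat.finrank p K] at h1
    rcases h1 with h1 | h1
    · have := (pow_eq_one_iff_of_nonneg (by positivity) (Nat.totient_pos.mpr hp.out.pos).ne').mp h1
      exact hq.one_lt.ne' (by exact_mod_cast this)
    · have h2 : (0 : ℤ) ≤ (q : ℤ) ^ p.totient := by positivity
      rw [h1] at h2
      norm_num at h2
  haveI : CharP (𝓞 K ⧸ Ideal.span {(q : 𝓞 K)}) q := CharP.quotient (𝓞 K) q hqnu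
  haveI := isReduced_quotient_span_prime (p := p) (K := K) hq hpq
  set π := Ideal.Quotient.mk (Ideal.span {(q : 𝓞 K)}) with hπ
  have h1 : π a ^ q - π b ^ q = 0 := by
    rw [← map_pow, ← map_pow, ← map_sub, Ideal.Quotient.eq_zero_iff_mem, Ideal.mem_span_singleton]
    exact h
  have h2 : (π a - π b) ^ q = 0 := by rw [sub_pow_char, h1]
  have h3 : π a - π b = 0 := IsReduced.eq_zero _ ⟨q, h2⟩
  have hab : (q : 𝓞 K) ∣ a - b := by
    rw [← map_sub, Ideal.Quotient.eq_zero_iff_mem, Ideal.mem_span_singleton] at h3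
    exact h3
  exact ⟨hab, by simpa using dvd_sub_pow_of_dvd_sub hab 1⟩

/-- **[Schoof2009, Proposition 14.2] (kernel).** Let `q < p` be odd primes, `K` a `p`-th
cyclotomic field and `ζ` a primitive `p`-th root of unity. Then the cyclotomic unit `ζ^q - 1` is
not congruent to a `q`-th power modulo `q²`: there is no `u ∈ 𝓞 K` with
`q² ∣ (ζ^q - 1) - u^q`. (If it were, `ζ` would be a root modulo `q` of the Witt polynomial
`((T-1)^q - T^q + 1)/(qT)` of degree `q - 2 < p - 1`.) [cite: Schoof2009, Proposition 14.2] -/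
theorem not_sq_dvd_zeta_pow_sub_one_sub_pow (hζ : IsPrimitiveRoot ζ p) {q : ℕ} (hq : q.Prime)
    (hqo : Odd q) (hqp : q < p) (u : 𝓞 K) :
    ¬ (q : 𝓞 K) ^ 2 ∣ (hζ.toInteger ^ q - 1) - u ^ q := by
  classical
  intro hdvd
  haveI : Fact q.Prime := ⟨hq⟩
  haveI : NeZero p := ⟨hp.out.ne_zero⟩
  have hpq : p ≠ q := by omega
  set z : 𝓞 K := hζ.toInteger with hzdef
  -- the polynomial `P = ∑_{0<k<q} (C(q,k)/q) (-1)^(q-k) X^k ∈ ℤ[X]` with `(X-1)^q = X^q - 1 + q P`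
  set P : ℤ[X] := ∑ k ∈ Ioo 0 q, C ((-1) ^ (q - k) * ((q.choose k / q : ℕ) : ℤ)) * X ^ k with hPdef
  have hPz : (z - 1) ^ q = z ^ q - 1 + q * aeval z P := by
    have h1 := add_pow_prime_eq' hq z (-1)
    rw [← sub_eq_add_neg, hqo.neg_one_pow] at h1
    rw [h1, hPdef, map_sum]
    congr 1
    · ring
    · congr 1
      refine sum_congr rfl fun k _ => ?_
      rw [map_mul, aeval_C, aeval_X_pow, algebraMap_int_eq, eq_intCast, Int.cast_mul, Int.cast_pow,
        Int.cast_neg, Int.cast_one, Int.cast_natCast]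
      ring
  -- `q ∣ P(z)`
  have hqz : (q : 𝓞 K) ∣ aeval z P := by
    have h0 : (q : 𝓞 K) ≠ 0 := by exact_mod_cast hq.ne_zero
    -- `q ∣ (z-1)^q - u^q`, hence `q² ∣ (z-1)^q - u^q`
    have h1 : (q : 𝓞 K) ∣ (z - 1) ^ q - u ^ q := by
      have h2 : (z - 1) ^ q - u ^ q = ((z ^ q - 1) - u ^ q) + q * aeval z P := by rw [hPz]; ring
      rw [h2]
      exact dvd_add ((dvd_pow_self _ two_ne_zero).trans hdvd) (dvd_mul_right _ _)
    have h3 := (sq_dvd_pow_sub_pow_of_dvd hq hpq h1).2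
    have h4 : (q : 𝓞 K) ^ 2 ∣ ((z - 1) ^ q - u ^ q) - ((z ^ q - 1) - u ^ q) := dvd_sub h3 hdvd
    rw [show ((z - 1) ^ q - u ^ q) - ((z ^ q - 1) - u ^ q) = q * aeval z P by rw [hPz]; ring,
      sq] at h4
    exact (mul_dvd_mul_iff_left h0).mp h4
  -- `P(z)/q ∈ ℤ[z]`: `P(z) = q G(z)` with `G ∈ ℤ[X]`
  obtain ⟨y, hy⟩ := hqz
  have hymem : y ∈ Algebra.adjoin ℤ {z} := by
    rw [hzdef, IsCyclotomicExtension.Rat.adjoin_singleton_eq_top hζ]; trivial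
  rw [Algebra.adjoin_singleton_eq_range_aeval] at hymem
  obtain ⟨G, hG⟩ := hymem
  have hy' : aeval z P = q * aeval z G := by rw [hy, ← hG]; rfl
  -- hence `Φ_p ∣ P - q G` in `ℤ[X]` (minimal polynomial), and `Φ_p ∣ P` in `𝔽_q[X]`
  have hroot : aeval ζ (P - C (q : ℤ) * G) = 0 := by
    have h1 : aeval ζ P = algebraMap (𝓞 K) K (aeval z P) := by
      rw [hzdef, ← aeval_algebraMap_apply]; rfl
    have h2 : aeval ζ G = algebraMap (𝓞 K) K (aeval z G) := by
      rw [hzdef, ← aeval_algebraMap_apply]; rfl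
    rw [map_sub, map_mul, aeval_C, h1, h2, hy', map_mul, map_natCast, algebraMap_int_eq,
      eq_intCast, Int.cast_natCast, sub_self]
  have hmin : cyclotomic p ℤ ∣ P - C (q : ℤ) * G := by
    rw [cyclotomic_eq_minpoly hζ hp.out.pos]
    exact minpoly.isIntegrallyClosed_dvd (hζ.isIntegral hp.out.pos) hroot
  have hmodq : cyclotomic p (ZMod q) ∣ P.map (Int.castRingHom (ZMod q)) := by
    have h1 := Polynomial.map_dvd (Int.castRingHom (ZMod q)) hmin
    rwa [map_cyclotomic, Polynomial.map_sub, Polynomial.map_mul, map_C, eq_intCast,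
      Int.cast_natCast, ZMod.natCast_self, map_zero, zero_mul, sub_zero] at h1
  -- degrees: `P mod q` is non-zero of degree `≤ q - 1 < p - 1 = deg Φ_p`
  have hq2 : 2 ≤ q := hq.two_le
  set Pq : (ZMod q)[X] := P.map (Int.castRingHom (ZMod q)) with hPq
  have hcoeffZ : P.coeff (q - 1) = -1 := by
    rw [hPdef, finsetSum_coeff, sum_eq_single (q - 1)]
    · rw [coeff_C_mul, coeff_X_pow, if_pos rfl, mul_one, show q - (q - 1) = 1 by omega, pow_one,
        Nat.choose_symm (by omega : 1 ≤ q), Nat.choose_one_right, Nat.div_self hq.pos]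
      norm_num
    · intro k _ hne
      rw [coeff_C_mul, coeff_X_pow, if_neg (Ne.symm hne), mul_zero]
    · intro h
      exact absurd (mem_Ioo.mpr ⟨by omega, by omega⟩) h
  have hcoeff : Pq.coeff (q - 1) = -1 := by
    rw [hPq, coeff_map, hcoeffZ]
    simp
  have hPq0 : Pq ≠ 0 := fun h0 => by
    rw [h0, coeff_zero] at hcoeff
    exact one_ne_zero (neg_eq_zero.mp hcoeff.symm)
  have hdegP : P.natDegree ≤ q - 1 := by
    rw [hPdef]
    refine natDegree_sum_le_of_forall_le _ _ fun k hk => ?_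
    exact (natDegree_C_mul_X_pow_le _ _).trans (by have := (mem_Ioo.mp hk).2; omega)
  have hdegPq : Pq.natDegree ≤ q - 1 := (natDegree_map_le).trans hdegP
  have hdegΦ : (cyclotomic p (ZMod q)).natDegree = p - 1 := by
    rw [natDegree_cyclotomic, Nat.totient_prime hp.out]
  have hle := natDegree_le_of_dvd hmodq hPq0
  rw [hdegΦ] at hle
  omega

end Catalan

end Literature.NumberTheory.DiophantineGeometry
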